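import Literature.MathematicalPhysics.QuantumFieldTheory.Balaban1983to89.B8LeafModelZdPer

/-!
# `Balaban1983to89.B8LeafModelZd3SockPer` — [Balaban1985RegularSpaces] (1.57)–(1.59) p. 86 ∕ [Balaban1985BackgroundPropagators] Thm 3.3: THE
# PERIODIC-GUARDED JUNCTION SOCKET `SockB9P3Per` — dag-n05-a's in-edge socket `B8LeafModelZd3.SockB9P3` VERBATIM with three guards «`U₀`, `W`, `A′` are
# `P`-periodic» (the torus `T_η` of p. 77 read on `ℤᵈ`): the ONE socket name shared by the (β′-PERIODIC) road of cell `pub-ymgap` (N05 ⇐ N06 junction at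
# `Ω 0 = univ` periodic members) and cell `lit-balaban`'s torus datum `torusIdx` (RULING #9 ∕ word #27: their `B9P3PerAt` is this shape)

statement-level skeleton of published theorems with citation tags; proofs where landed; nothing here is a claim about the
Yang–Mills mass gap

`[Balaban1985RegularSpaces]` ("B8", CMP **99** (1985) 75–102): p. 77 (*«we admit the case when some domains Ω_j are equal to T_η»*), (1.7) p. 77, (1.38),
(1.40)–(1.42) pp. 82–83, (1.57)–(1.59) p. 86 (*«A = G(U₀)J − … where the operator G(U₀) was introduced and investigated in [4]»*, the five lines of
(1.59)).  `[Balaban1985BackgroundPropagators]` ("B9") Thm 3.3 p. 398–399, (3.27) p. 395, Thm 3.11 p. 416.  `[Balaban1985Averaging]` (4) p. 18 (the torus).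

CITATION HEADER ∕ WHY THIS FILE (cell `pub-ymgap`, HUMAN RULING D-0062; seat `pub-ymgap-dag-n06-b` (g22), junction ∕ letter lineage J-N06→N05; asked for by
lit-balaban lead g32 word #27 (2) «(Q-b) YES, word `SockB9P3Per` now, one name for both cells» and posed to dag-n05-d ∕ dag-n05-c (P4 ∕ P1 pens of the
(β′-PERIODIC) road, plan g86 PENS-217)).  N06's periodic OBJECTS (`B9Eq327GreenZdHermPer.gopZdHPer`, `B9SupplySockB9P3ZdAllLettersZdPer.opsAllZdPer`, dag-n06-w4's
`projRPer`) supply (3.27) ∕ (3.20) ∕ (3.69) ∕ (3.16) ∕ (3.47) at PERIODIC backgrounds and fields only; the unguarded `SockB9P3` at `Ω 0 = univ` quantifies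
over ALL bond fields on `ℤᵈ` = [4] in infinite volume (dag-n05-d JUNCTION ROAD NOTE v2 (3)) and is not what print uses: [B8]'s Theorems 2 ∕ 4 ∕ 8 and
Propositions 3 ∕ 7 live on the finite torus `T_η`, every configuration `U₀`, perturbation `W = U′` and exponent `A′` there IS periodic when read on
`ℤᵈ`.  THIS FILE is the agreed text: `SockB9P3Per P …` = `SockB9P3 …` with `IsPeriodic P U₀ →`, `IsPeriodic P W →` after the two unitarity clauses and
`IsPeriodic P A′ →` after the Hermitian clause — NOTHING else changed (the five lines of (1.59) byte-identical) —, the trivial direction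
`SockB9P3 ⟹ SockB9P3Per`, antitonicity in `cP`, and the per-direction reading of the guards (lit-balaban's displayed form `∀ z i, F (z + P • e i) = F z`,
P1's `isPeriodic_iff_shiftCfg`).

WHAT IS DECLARED ∕ PROVED (1 def + bookkeeping; no `sorry`, no `instance`, no `notation`).
* ★ `SockB9P3Per P L B₀ B₀β cP β len η k Ω Λs Λb` (the guarded socket).
* `sockB9P3Per_of_sockB9P3` (drop the guards) · `sockB9P3Per_anti` (antitone in `cP`) · `isPeriodic_of_forall_shift_e` ∕ `forall_shift_e_of_isPeriodic`
  (the per-direction form `∀ z i, F (z + P•e_i) = F z` ↔ `IsPeriodic P F`, via P1's `isPeriodic_iff_shiftCfg`) · `sockB9P3Per_apply_dir` (the socket fed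
  with guards in the per-direction form).

HONEST SCOPE.  A DEFINITION (the junction's socket text on the torus) + three one-line lemmas; nothing of [B8] ∕ [B9] is proved; the SUPPLIER
(N06: `SockB9P3Per` at a periodic member from `InvAtHIPer` ∕ the periodic Landau ∕ curvature ∕ averaging ∕ (3.47) binders — [B8] p. 86's chain) and the
CONSUMER re-typing (N05 P4 ∕ P1: `prop3Printed_zdPer` from the guarded socket) are separate files.  Count-neutral; N05 ∕ N06 NOT discharged; K1⁹
`stmt-QuantumFields-27364` NOT closed; one finite `𝕋⁴` programme at fixed `ε`, Bałaban as printed; R4 closes only the conditional finite-`𝕋⁴` rung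
`BalabanLadder.UV` — nothing continuum ∕ ℝ⁴ ∕ OS ∕ mass gap ∕ Clay.  Unit `pub-ymgap-dag-n06-b` (g22), 2026-08-28.
-/

noncomputable section

namespace Literature.MathematicalPhysics.QuantumFieldTheory.Balaban1983to89.B8LeafModelZd3SockPer

open B7Prop1Explicit B7Prop2Explicit
open B7Prop4GeneralLevels (linCovIter)
open B8Ineq132 (covDerivFwd InAk BondTouches)
open B8Eq184Proof (cfgExp)
open B8Lemma1NonAbelian (mulCfg)
open B8Eq140Level (SideTouches)
open B8Eq146AExpansion (iEta plaqCovDeriv)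
open B8Eq143PlaqExpansion (pdiv)
open B8Eq155JBound (Jcur wsup)
open B8ScaledSupNorm (bondNorm msup)
open B8Eq138LandauZd (IsLandau138W covLap)
open B8LeafModelZd3 (SockB9P3)
open B9Eq340HolderZd (hquot AdmPair)
open B12Ineq417Flat (shiftCfg shiftCfg_apply)
open T4TermwiseTorus (IsPeriodic)

-- `Site` alone could resolve to the torus sites of `Setup.lean`; re-export the `ℤ^d` sites of `B7Prop1Explicit`.
export B7Prop1Explicit (Site)

variable {d : ℕ} {𝔸 : Type*} [CStarAlgebra 𝔸]

/-- ★ **THE PERIODIC-GUARDED IN-EDGE SOCKET OF PROPOSITION 3's FRAME** — `B8LeafModelZd3.SockB9P3` (Theorem 3.3 of [4] for `G(U₀)` read through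
(1.57)–(1.58): the FIVE lines of (1.59)) with the three data of the torus READ AS PERIODIC: for `P`-PERIODIC unitary `U₀`, `W` with (1.40)
`U₀, WU₀ ∈ 𝔄_k({Ω_j}, α₀)`, the Landau condition of record (1.38)∕(1.42)₁ for `W`, and a `P`-PERIODIC Hermitian exponent field `A′` with `W = e^{iηA′}`,
(1.41) on the sides of the plaquettes touching `Ω_j` and `A′ = 0` off them:
`|A′|₍₋₁₎, |∇^η_{U₀}A′|₍₋₂₎, |D^{η*}D^ηA′|₍₋₃₎, |Δ^η_{U₀}A′|₍₋₃₎ ≤ B₀(|J|₍₋₃₎ + |B₁|)` and the Hölder line with `B₀(β)` — VERBATIM.  Guarded by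
`α₀, α₂ ≤ cP`.  On the torus `T_η = (ℤ∕P)ᵈ` of [B8] p. 77 every `U₀`, `W = U′`, `A′` of Prop. 3 is periodic on `ℤᵈ`, so this is the socket print
uses; it is what N06's periodic objects (`G_𝔤^per`, `R^per`, …) can supply per member.
[cite: Balaban1985RegularSpaces, (1.57)–(1.59) p.86, (1.40)–(1.42) p.83, p.77 («we admit the case when some domains Ω_j are equal to T_η»); Balaban1985BackgroundPropagators, Thm 3.3 p.398; Balaban1985Averaging, (4) p.18] -/
def SockB9P3Per (P : ℕ) (L : ℕ) (B₀ B₀β cP β : ℝ) (len : Site d → ℝ) (η : ℝ) (k : ℕ) (Ω : ℕ → Set (Site d))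
    (Λs : ℕ → ℕ → Set (Site d)) (Λb : ℕ → ℕ → Set (Site d × Fin d)) : Prop :=
  ∀ α₀ α₂ : ℝ, 0 < α₀ → α₀ ≤ cP → 0 < α₂ → α₂ ≤ cP →
    ∀ (U₀ W : Site d → Fin d → 𝔸ˣ), (∀ x κ, U₀ x κ ∈ unitaryUnits 𝔸) → (∀ x κ, W x κ ∈ unitaryUnits 𝔸) →
    IsPeriodic P U₀ → IsPeriodic P W →
    InAk L k η α₀ Ω U₀ → InAk L k η α₀ Ω (mulCfg W U₀) → IsLandau138W L k η (Ω 0) (Λs k) U₀ W →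
    ∀ A' : Site d → Fin d → 𝔸, (∀ y τ, IsSelfAdjoint (A' y τ)) → IsPeriodic P A' →
    (∀ j, j ≤ k → ∀ (y : Site d) (τ : Fin d), SideTouches (Ω j) y τ →
      W y τ = cfgExp η A' y τ ∧ ‖A' y τ‖ ≤ α₂ * ((L : ℝ) ^ j * η)⁻¹) →
    (∀ (y : Site d) (τ : Fin d), (∀ j, j ≤ k → ¬ SideTouches (Ω j) y τ) → A' y τ = 0) →
    msup L k η (-(1 : ℝ)) (fun j (b : Site d × Fin d) => SideTouches (Ω j) b.1 b.2) (fun b => A' b.1 b.2)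
        ≤ B₀ * (bondNorm L k η (-(3 : ℝ)) Ω (fun x μ => Jcur η U₀ A' μ x)
          + wsup 1 (fun p : {p : ℕ × (Site d × Fin d) // p.1 ≤ k ∧ p.2 ∈ Λb k p.1} =>
              linCovIter L U₀ (iEta η A') p.1.1 p.1.2.1 p.1.2.2)) ∧
      msup L k η (-(2 : ℝ)) (fun j (t : Fin d × Fin d × Site d) => SideTouches (Ω j) t.2.2 t.2.1)
          (fun t => covDerivFwd η U₀ t.1 (fun z => A' z t.2.1) t.2.2)
        ≤ B₀ * (bondNorm L k η (-(3 : ℝ)) Ω (fun x μ => Jcur η U₀ A' μ x)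
          + wsup 1 (fun p : {p : ℕ × (Site d × Fin d) // p.1 ≤ k ∧ p.2 ∈ Λb k p.1} =>
              linCovIter L U₀ (iEta η A') p.1.1 p.1.2.1 p.1.2.2)) ∧
      bondNorm L k η (-(3 : ℝ)) Ω (fun x μ => pdiv η U₀ (plaqCovDeriv η U₀ A') μ x)
        ≤ B₀ * (bondNorm L k η (-(3 : ℝ)) Ω (fun x μ => Jcur η U₀ A' μ x)
          + wsup 1 (fun p : {p : ℕ × (Site d × Fin d) // p.1 ≤ k ∧ p.2 ∈ Λb k p.1} =>
              linCovIter L U₀ (iEta η A') p.1.1 p.1.2.1 p.1.2.2)) ∧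
      bondNorm L k η (-(3 : ℝ)) Ω (fun x μ => covLap η U₀ (fun z => A' z μ) x)
        ≤ B₀ * (bondNorm L k η (-(3 : ℝ)) Ω (fun x μ => Jcur η U₀ A' μ x)
          + wsup 1 (fun p : {p : ℕ × (Site d × Fin d) // p.1 ≤ k ∧ p.2 ∈ Λb k p.1} =>
              linCovIter L U₀ (iEta η A') p.1.1 p.1.2.1 p.1.2.2)) ∧
      msup L k η (-(2 + β)) (fun j (q : Fin d × Fin d × (Site d × Site d)) => q.2.2 ∈ AdmPair η len ∧ q.2.2.1 ∈ Ω j)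
          (fun q => hquot η β len U₀ (covDerivFwd η U₀ q.1 (fun z => A' z q.2.1)) q.2.2)
        ≤ B₀β * (bondNorm L k η (-(3 : ℝ)) Ω (fun x μ => Jcur η U₀ A' μ x)
          + wsup 1 (fun p : {p : ℕ × (Site d × Fin d) // p.1 ≤ k ∧ p.2 ∈ Λb k p.1} =>
              linCovIter L U₀ (iEta η A') p.1.1 p.1.2.1 p.1.2.2))

/-- **THE UNGUARDED SOCKET IMPLIES THE GUARDED ONE** (drop the three periodicity hypotheses). [cite: Balaban1985RegularSpaces, (1.59) p.86, p.77 («Ω_j = T_η»)] -/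
theorem sockB9P3Per_of_sockB9P3 (P : ℕ) {L : ℕ} {B₀ B₀β cP β : ℝ} {len : Site d → ℝ} {η : ℝ} {k : ℕ} {Ω : ℕ → Set (Site d)}
    {Λs : ℕ → ℕ → Set (Site d)} {Λb : ℕ → ℕ → Set (Site d × Fin d)} (S : SockB9P3 (𝔸 := 𝔸) L B₀ B₀β cP β len η k Ω Λs Λb) :
    SockB9P3Per (𝔸 := 𝔸) P L B₀ B₀β cP β len η k Ω Λs Λb :=
  fun α₀ α₂ hα₀ hα₀c hα₂ hα₂c U₀ W hU₀ hW _ _ hInU hInW hLan A' hsa _ hexp hoff =>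
    S α₀ α₂ hα₀ hα₀c hα₂ hα₂c U₀ W hU₀ hW hInU hInW hLan A' hsa hexp hoff

/-- `SockB9P3Per` is antitone in the threshold `cP`. [cite: Balaban1985RegularSpaces, (1.59) p.86 (bookkeeping)] -/
theorem sockB9P3Per_anti {P L : ℕ} {B₀ B₀β cP cP' β : ℝ} {len : Site d → ℝ} (h : cP' ≤ cP) {η : ℝ} {k : ℕ} {Ω : ℕ → Set (Site d)}
    {Λs : ℕ → ℕ → Set (Site d)} {Λb : ℕ → ℕ → Set (Site d × Fin d)} (S : SockB9P3Per (𝔸 := 𝔸) P L B₀ B₀β cP β len η k Ω Λs Λb) :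
    SockB9P3Per (𝔸 := 𝔸) P L B₀ B₀β cP' β len η k Ω Λs Λb :=
  fun α₀ α₂ hα₀ hα₀c hα₂ hα₂c => S α₀ α₂ hα₀ (hα₀c.trans h) hα₂ (hα₂c.trans h)

omit [CStarAlgebra 𝔸] in
/-- **THE PER-DIRECTION READING OF THE GUARDS** (lit-balaban's displayed form in `B9P3PerAt`): `∀ z i, F (z + P•e_i) = F z` ⟹ `IsPeriodic P F` (P1's
`B8LeafModelZdPer.isPeriodic_iff_shiftCfg`). [cite: Balaban1985RegularSpaces, p.77 («Ω_j = T_η»; bookkeeping)] -/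
theorem isPeriodic_of_forall_shift_e {β : Type*} {P : ℕ} {F : Site d → β} (h : ∀ (z : Site d) (i : Fin d), F (z + (P : ℤ) • e i) = F z) :
    IsPeriodic P F :=
  (B8LeafModelZdPer.isPeriodic_iff_shiftCfg (P := P) F).2 fun μ => funext fun x => by rw [shiftCfg_apply]; exact h x μ

omit [CStarAlgebra 𝔸] in
/-- … and conversely `IsPeriodic P F` ⟹ `∀ z i, F (z + P•e_i) = F z`. [cite: Balaban1985RegularSpaces, p.77 («Ω_j = T_η»; bookkeeping)] -/
theorem forall_shift_e_of_isPeriodic {β : Type*} {P : ℕ} {F : Site d → β} (h : IsPeriodic P F) (z : Site d) (i : Fin d) :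
    F (z + (P : ℤ) • e i) = F z := by
  have h1 := (B8LeafModelZdPer.isPeriodic_iff_shiftCfg (P := P) F).1 h i
  have h2 := congrFun h1 z
  rwa [shiftCfg_apply] at h2

/-- **THE GUARDED SOCKET FED WITH GUARDS IN THE PER-DIRECTION FORM** (the shape cell `lit-balaban`'s `B9P3PerAt` displays): a 1-line adapter.
[cite: Balaban1985RegularSpaces, (1.59) p.86, p.77 («Ω_j = T_η»)] -/
theorem sockB9P3Per_apply_dir {P L : ℕ} {B₀ B₀β cP β : ℝ} {len : Site d → ℝ} {η : ℝ} {k : ℕ} {Ω : ℕ → Set (Site d)}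
    {Λs : ℕ → ℕ → Set (Site d)} {Λb : ℕ → ℕ → Set (Site d × Fin d)} (S : SockB9P3Per (𝔸 := 𝔸) P L B₀ B₀β cP β len η k Ω Λs Λb)
    {α₀ α₂ : ℝ} (hα₀ : 0 < α₀) (hα₀c : α₀ ≤ cP) (hα₂ : 0 < α₂) (hα₂c : α₂ ≤ cP)
    {U₀ W : Site d → Fin d → 𝔸ˣ} (hU₀ : ∀ x κ, U₀ x κ ∈ unitaryUnits 𝔸) (hW : ∀ x κ, W x κ ∈ unitaryUnits 𝔸)
    (hU₀p : ∀ (z : Site d) (i : Fin d), U₀ (z + (P : ℤ) • e i) = U₀ z) (hWp : ∀ (z : Site d) (i : Fin d), W (z + (P : ℤ) • e i) = W z)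
    (hInU : InAk L k η α₀ Ω U₀) (hInW : InAk L k η α₀ Ω (mulCfg W U₀)) (hLan : IsLandau138W L k η (Ω 0) (Λs k) U₀ W)
    {A' : Site d → Fin d → 𝔸} (hsa : ∀ y τ, IsSelfAdjoint (A' y τ)) (hA'p : ∀ (z : Site d) (i : Fin d), A' (z + (P : ℤ) • e i) = A' z)
    (hexp : ∀ j, j ≤ k → ∀ (y : Site d) (τ : Fin d), SideTouches (Ω j) y τ →
      W y τ = cfgExp η A' y τ ∧ ‖A' y τ‖ ≤ α₂ * ((L : ℝ) ^ j * η)⁻¹)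
    (hoff : ∀ (y : Site d) (τ : Fin d), (∀ j, j ≤ k → ¬ SideTouches (Ω j) y τ) → A' y τ = 0) :
    msup L k η (-(1 : ℝ)) (fun j (b : Site d × Fin d) => SideTouches (Ω j) b.1 b.2) (fun b => A' b.1 b.2)
        ≤ B₀ * (bondNorm L k η (-(3 : ℝ)) Ω (fun x μ => Jcur η U₀ A' μ x)
          + wsup 1 (fun p : {p : ℕ × (Site d × Fin d) // p.1 ≤ k ∧ p.2 ∈ Λb k p.1} =>
              linCovIter L U₀ (iEta η A') p.1.1 p.1.2.1 p.1.2.2)) ∧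
      msup L k η (-(2 : ℝ)) (fun j (t : Fin d × Fin d × Site d) => SideTouches (Ω j) t.2.2 t.2.1)
          (fun t => covDerivFwd η U₀ t.1 (fun z => A' z t.2.1) t.2.2)
        ≤ B₀ * (bondNorm L k η (-(3 : ℝ)) Ω (fun x μ => Jcur η U₀ A' μ x)
          + wsup 1 (fun p : {p : ℕ × (Site d × Fin d) // p.1 ≤ k ∧ p.2 ∈ Λb k p.1} =>
              linCovIter L U₀ (iEta η A') p.1.1 p.1.2.1 p.1.2.2)) ∧
      bondNorm L k η (-(3 : ℝ)) Ω (fun x μ => pdiv η U₀ (plaqCovDeriv η U₀ A') μ x)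
        ≤ B₀ * (bondNorm L k η (-(3 : ℝ)) Ω (fun x μ => Jcur η U₀ A' μ x)
          + wsup 1 (fun p : {p : ℕ × (Site d × Fin d) // p.1 ≤ k ∧ p.2 ∈ Λb k p.1} =>
              linCovIter L U₀ (iEta η A') p.1.1 p.1.2.1 p.1.2.2)) ∧
      bondNorm L k η (-(3 : ℝ)) Ω (fun x μ => covLap η U₀ (fun z => A' z μ) x)
        ≤ B₀ * (bondNorm L k η (-(3 : ℝ)) Ω (fun x μ => Jcur η U₀ A' μ x)
          + wsup 1 (fun p : {p : ℕ × (Site d × Fin d) // p.1 ≤ k ∧ p.2 ∈ Λb k p.1} =>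
              linCovIter L U₀ (iEta η A') p.1.1 p.1.2.1 p.1.2.2)) ∧
      msup L k η (-(2 + β)) (fun j (q : Fin d × Fin d × (Site d × Site d)) => q.2.2 ∈ AdmPair η len ∧ q.2.2.1 ∈ Ω j)
          (fun q => hquot η β len U₀ (covDerivFwd η U₀ q.1 (fun z => A' z q.2.1)) q.2.2)
        ≤ B₀β * (bondNorm L k η (-(3 : ℝ)) Ω (fun x μ => Jcur η U₀ A' μ x)
          + wsup 1 (fun p : {p : ℕ × (Site d × Fin d) // p.1 ≤ k ∧ p.2 ∈ Λb k p.1} =>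
              linCovIter L U₀ (iEta η A') p.1.1 p.1.2.1 p.1.2.2)) :=
  S _ _ hα₀ hα₀c hα₂ hα₂c U₀ W hU₀ hW (isPeriodic_of_forall_shift_e hU₀p) (isPeriodic_of_forall_shift_e hWp) hInU hInW hLan A' hsa
    (isPeriodic_of_forall_shift_e hA'p) hexp hoff

end Literature.MathematicalPhysics.QuantumFieldTheory.Balaban1983to89.B8LeafModelZd3SockPer

end
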